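import Summits.Schanuel.Schanuel.Theses.AdelicLogSector
import Summits.Schanuel.Schanuel.Theses.BenfordTowers
import HarnessLib

/-!
# Line `birth` — birth skeleton for crux `PrimeLogSector` (stmt-Schanuel-7091)

Crux (route AdelicLogSector #9, auto-promoted support → crux 2026-08-16; byte-identical decl in
route BenfordTowers #9): **the prime-log sector** — for distinct primes `ℓ₁,…,ℓ_r`, the real numbers
`log ℓ₁, …, log ℓ_r` are algebraically independent over `ℚ`,
`∀ r (ℓ : Fin r → ℕ), (∀ i, (ℓ i).Prime) → Function.Injective ℓ →
AlgebraicIndependent ℚ (fun i => Real.log (ℓ i))` (the `k = ℚ` real slice of AlgIndepLogs;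
Waldschmidt2005 Conj. 1.1; no two logarithms of primes are known algebraically independent).

## The cut (planner skeleton registrar, 2026-08-17)

The skeleton is the route's OWN line to the sector (thesis of AdelicLogSector: "a real relation among
logs of primes must show in Fermat quotients at every large `p`; Fermat-quotient genericity forbids
it"), i.e. the two ranked cruxes of the route as the two named stubs, and the route's glue support
`PrimeLogSectorOfTransfer` (stmt-Schanuel-7092, "elementary, provable now") actually PROVED as the
composition:

* stub **TRANSFER** `stub_transferModP` (OPEN; = route crux `TransferModP`, stmt-Schanuel-7088,
  rank 2, byte-identical statement): an integer polynomial relation `P(log ℓ) = 0` whose homogeneous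
  parts below degree `d` vanish forces `P_d(q_p(ℓ₁),…,q_p(ℓ_r)) ≡ 0 (mod p)` for all large primes
  `p` (`q_p(ℓ) = (ℓ^{p−1} − 1)/p` the Fermat quotient = first digit of the André `p`-adic period
  `log_p ℓ` of the Kummer motive, arXiv:2207.09213 Ex. 9.6). Implied by the crux
  (`TransferOfPrimeLogSector`, vacuity) but not conversely: it is the "mod-`p` shadow" half.
* stub **GENERICITY** `stub_fermatQuotientGenericity` (OPEN; = route crux
  `FermatQuotientGenericity`, stmt-Schanuel-7089, rank 3, byte-identical statement): for distinct
  primes `ℓᵢ` and every nonzero `Q ∈ ℤ[X₁..X_r]`, `Q(q_p(ℓ₁),…,q_p(ℓ_r)) ≢ 0 (mod p)` for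
  infinitely many `p` (degree one = infinitely many non-Wieferich primes per base, open, known
  under abc: Silverman1988). NOT a consequence of Schanuel — the genuinely arithmetic input.

`PrimeLogSector_of (hT : Statement.stub_transferModP) (hG : Statement.stub_fermatQuotientGenericity)
: AdelicLogSector.PrimeLogSector` (sorry-free; stub statements BY NAME via `type_of%` abbrevs;
`PrimeLogSector_proof` plugs the sorried stubs in; `PrimeLogSector_proofBenfordTowers` concludes the
byte-identical decl of the sharing route; `primeLogSectorOfTransfer` is the route support item
`PrimeLogSectorOfTransfer` BY NAME, sorry-free — a candidate proof for stmt-Schanuel-7092): a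
nonzero `P ∈ ℚ[X]` with `P(log ℓ) = 0` is cleared to an integer `Q ≠ 0` with `Q(log ℓ) = 0`
(`ℚ[X_σ]` is the localisation of `ℤ[X_σ]` at `ℤ ∖ 0`, `MvPolynomial.isLocalization`); `d` := the
least degree with `Q_d ≠ 0` (`Nat.find` on `MvPolynomial.sum_homogeneousComponent`); TRANSFER gives
`p₀` with `Q_d(q_p ℓ) ≡ 0 (mod p)` for all primes `p ≥ p₀`; GENERICITY at `Q_d`, `p₀` gives such a
`p` where it does not vanish — contradiction. The composition is a genuine two-piece cut (neither
stub is the crux reworded: TRANSFER is strictly weaker than the sector modulo nothing known,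
GENERICITY is logically independent of it and of Schanuel; the two halves have disjoint tool-kits —
`p`-adic periods / crystalline comparison vs. Wieferich-type congruences).

Disproof used: none on file (`ledger crux ls stmt-Schanuel-7091`: no workfiles, no `Disproof.lean`,
2026-08-17). Negatives index consulted (`ledger negatives --problem Schanuel`, 2026-08-17: two
entries, `PolarPhantomsPhantomsAreTraceless_refuted` / `PolarPhantomsPolarSchanuel_refuted`, both the
negation of a `trdeg < n` phantom statement over `ℂ` — unrelated to Fermat quotients or to
`AlgebraicIndependent ℚ (log ∘ ℓ)`; no stub is an instance of either).

BC3 probes (planner folder `bc/stub_transferModP_probe.lean`, `bc/stub_fermatQuotientGenericity_probe.lean`,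
importing ONLY the route file, stub restated verbatim; lean check 2026-08-17, rc 1 each): for each
of the two stubs, `stub → PrimeLogSector` and `stub → Schanuel` by
`first | exact? | simpa [Stub, C] | (unfold Stub C; simpa) | aesop` FAIL (unsolved goals /
`exact?` could not close the goal / heartbeat timeout in `exact?` on the `Schanuel` goal), the
per-tactic variants (`exact?`, `simpa`, `aesop` separately) FAIL, and `stub` itself by
`first | exact? | simp [Stub] | aesop` FAILS — 18/18 probes fail: no stub is cheaply the crux, the
summit, or a tree one-liner.
-/

set_option linter.dupNamespace false

namespace Summit.Schanuel.Schanuel.Cruxes.PrimeLogSector.Birth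

open Summit.Schanuel.Schanuel.Theses.AdelicLogSector (PrimeLogSector TransferModP
  FermatQuotientGenericity)

/-! ### Registered stubs -/

/-- Stub **TRANSFER** (mod-`p` shadow; = route decl `AdelicLogSector.TransferModP`,
stmt-Schanuel-7088, byte-identical body): for distinct primes `ℓ₁,…,ℓ_r` and an integer polynomial
`P` whose homogeneous components below degree `d` vanish, `P(log ℓ₁,…,log ℓ_r) = 0` in `ℝ` forces
`P_d(q_p(ℓ₁),…,q_p(ℓ_r)) ≡ 0 (mod p)` for all sufficiently large primes `p`, where
`q_p(ℓ) = (ℓ^{p−1} − 1)/p` is the Fermat quotient. OPEN (degree one vacuous over `ℚ`; the first live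
case is the four-exponentials determinant `log 2·log 3 − log 5·log 7`). [cite: arXiv:2207.09213, Ex. 9.6] -/
theorem stub_transferModP :
    ∀ (r : ℕ) (ℓ : Fin r → ℕ), (∀ i, (ℓ i).Prime) → Function.Injective ℓ →
      ∀ (P : MvPolynomial (Fin r) ℤ) (d : ℕ), (∀ k < d, MvPolynomial.homogeneousComponent k P = 0) →
        MvPolynomial.aeval (fun i => Real.log (ℓ i)) P = 0 →
          ∃ p₀ : ℕ, ∀ p : ℕ, p₀ ≤ p → p.Prime →
            MvPolynomial.aeval (fun i => ((((ℓ i) ^ (p - 1) - 1) / p : ℕ) : ZMod p))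
              (MvPolynomial.homogeneousComponent d P) = 0 := by
  sorry

/-- Stub **GENERICITY** (= route decl `AdelicLogSector.FermatQuotientGenericity`,
stmt-Schanuel-7089, byte-identical body): for distinct primes `ℓ₁,…,ℓ_r` and every nonzero
`Q ∈ ℤ[X₁,…,X_r]` there are infinitely many primes `p` with `Q(q_p(ℓ₁),…,q_p(ℓ_r)) ≢ 0 (mod p)`.
OPEN (already `r = 1`, `Q = X₁` is "infinitely many non-Wieferich primes to base `ℓ`", known only
under abc). [cite: Silverman1988, Thm. 1] -/
theorem stub_fermatQuotientGenericity :
    ∀ (r : ℕ) (ℓ : Fin r → ℕ), (∀ i, (ℓ i).Prime) → Function.Injective ℓ →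
      ∀ Q : MvPolynomial (Fin r) ℤ, Q ≠ 0 → ∀ p₀ : ℕ, ∃ p : ℕ, p₀ ≤ p ∧ p.Prime ∧
        MvPolynomial.aeval (fun i => ((((ℓ i) ^ (p - 1) - 1) / p : ℕ) : ZMod p)) Q ≠ 0 := by
  sorry

/-! ### Stub statements by name -/

namespace Statement

/-- Statement of `stub_transferModP`. -/
abbrev stub_transferModP : Prop := type_of% @Birth.stub_transferModP
/-- Statement of `stub_fermatQuotientGenericity`. -/
abbrev stub_fermatQuotientGenericity : Prop := type_of% @Birth.stub_fermatQuotientGenericity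

end Statement

/-! ### Glue: clearing denominators -/

section Glue

attribute [local instance] MvPolynomial.algebraMvPolynomial

/-- Clearing denominators: every `P ∈ ℚ[X_σ]` is `m⁻¹ · Q` for an integer polynomial `Q` and a
nonzero integer `m` (`ℚ[X_σ]` is the localisation of `ℤ[X_σ]` at the nonzero integers,
`MvPolynomial.isLocalization`). [folklore] -/
theorem exists_intPoly_mul_eq_map {σ : Type*} (P : MvPolynomial σ ℚ) :
    ∃ (Q : MvPolynomial σ ℤ) (m : ℤ), m ≠ 0 ∧
      P * MvPolynomial.C (m : ℚ) = MvPolynomial.map (algebraMap ℤ ℚ) Q := by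
  obtain ⟨⟨Q, s⟩, h⟩ :=
    IsLocalization.surj ((nonZeroDivisors ℤ).map (MvPolynomial.C (σ := σ) (R := ℤ))) P
  obtain ⟨m, hm, hms⟩ := Submonoid.mem_map.1 s.2
  refine ⟨Q, m, nonZeroDivisors.ne_zero hm, ?_⟩
  have h' := h
  rw [MvPolynomial.algebraMap_def, ← hms, MvPolynomial.map_C] at h'
  simpa using h'

/-- The least-degree argument needs a nonzero homogeneous component. [folklore] -/
theorem exists_homogeneousComponent_ne_zero {σ : Type*} {R : Type*} [CommSemiring R]
    {Q : MvPolynomial σ R} (hQ : Q ≠ 0) : ∃ d, MvPolynomial.homogeneousComponent d Q ≠ 0 := by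
  by_contra h
  apply hQ
  rw [← MvPolynomial.sum_homogeneousComponent Q]
  exact Finset.sum_eq_zero fun i _ => not_not.1 (not_exists.1 h i)

end Glue

/-! ### The crux from the stubs (kernel-checked composition, no `sorry`) -/

/-- **The crux BY NAME from the two stub statements** (TRANSFER → GENERICITY →
`AdelicLogSector.PrimeLogSector`): a nonzero `P ∈ ℚ[X]` with `P(log ℓ) = 0` is cleared to an integer
`Q ≠ 0` with `Q(log ℓ) = 0`; let `d` be the least degree with `Q_d ≠ 0`; TRANSFER gives
`Q_d(q_p ℓ) ≡ 0 (mod p)` for all large `p`, GENERICITY applied to `Q_d` gives a large `p` where it does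
not vanish — contradiction. This is the route's support item `PrimeLogSectorOfTransfer`
(stmt-Schanuel-7092) proved. [folklore] -/
theorem PrimeLogSector_of (hT : Statement.stub_transferModP)
    (hG : Statement.stub_fermatQuotientGenericity) : PrimeLogSector := by
  intro r ℓ hprime hinj
  rw [algebraicIndependent_iff]
  intro P hP
  by_contra hP0
  obtain ⟨Q, m, hm, hQP⟩ := exists_intPoly_mul_eq_map P
  have hQ0 : Q ≠ 0 := by
    rintro rfl
    have hC : (MvPolynomial.C (m : ℚ) : MvPolynomial (Fin r) ℚ) ≠ 0 := by
      rw [Ne, MvPolynomial.C_eq_zero]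
      exact_mod_cast hm
    have : P * MvPolynomial.C (m : ℚ) = 0 := by simpa using hQP
    rcases mul_eq_zero.1 this with h | h
    · exact hP0 h
    · exact hC h
  have hQeval : MvPolynomial.aeval (fun i => Real.log (ℓ i)) Q = 0 := by
    rw [← MvPolynomial.aeval_map_algebraMap ℚ (fun i => Real.log (ℓ i)) Q, ← hQP, map_mul, hP,
      zero_mul]
  classical
  obtain ⟨p₀, hp₀⟩ := hT r ℓ hprime hinj Q (Nat.find (exists_homogeneousComponent_ne_zero hQ0))
    (fun k hk => not_not.1 (Nat.find_min (exists_homogeneousComponent_ne_zero hQ0) hk)) hQeval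
  obtain ⟨p, hp₀p, hp, hne⟩ := hG r ℓ hprime hinj _
    (Nat.find_spec (exists_homogeneousComponent_ne_zero hQ0)) p₀
  exact hne (hp₀ p hp₀p hp)

/-- The crux along this line (route `AdelicLogSector` decl, by name), MODULO exactly the two
registered stubs (depends on `sorryAx` only through `stub_*`). [folklore] -/
theorem PrimeLogSector_proof : PrimeLogSector :=
  PrimeLogSector_of stub_transferModP stub_fermatQuotientGenericity

/-- The same composition with the route's crux decls BY NAME as hypotheses: this is the support item
`AdelicLogSector.PrimeLogSectorOfTransfer` (stmt-Schanuel-7092), sorry-free. [folklore] -/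
theorem primeLogSectorOfTransfer :
    Summit.Schanuel.Schanuel.Theses.AdelicLogSector.PrimeLogSectorOfTransfer :=
  fun hT hG => PrimeLogSector_of hT hG

/-- The crux under the byte-identical decl of route `BenfordTowers` (the item stmt-Schanuel-7091 is
shared by routes AdelicLogSector / BenfordTowers), MODULO the two registered stubs. [folklore] -/
theorem PrimeLogSector_proofBenfordTowers :
    Summit.Schanuel.Schanuel.Theses.BenfordTowers.PrimeLogSector :=
  fun r ℓ hprime hinj => PrimeLogSector_of stub_transferModP stub_fermatQuotientGenericity r ℓ hprime hinj

end Summit.Schanuel.Schanuel.Cruxes.PrimeLogSector.Birth
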